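import Summits.QuantumFields.QCD.Theses.HeatSlicedQuarks
import Summits.QuantumFields.QCD.Theorems.SmallFieldUltracontractivity.Negative.LoadBearing

/-!
# Disproof of `TracedQuadraticParametrix` (stmt-QuantumFields-17985) — cdisprove work file

Status after cycle 1 (refuter-cdisprove-stmt-QuantumFields-17985-0, 2026-08-17): **NO KILL; the crux
resists.**  One load-bearing hypothesis certified (`r ≤ L`, §1, LANDED as
`Theorems/TracedQuadraticParametrix/Negative/FalseWithoutRLeL.lean`, p135978); the one regime the
earlier random-field numerics could not see (large potentials / tiny plaquettes: almost-commuting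
CONSTANT link quadruples, `t` up to `4096`) computed exactly and found bounded (§3); analysis of why
every cheap family is absorbed (§4).  Prose lives in docstrings only.

## Index
* §0 vocabulary: `trDiag`, `SmallPlaq`, `rhs`, `freeCfg`; `crux_iff : crux ↔ abbreviated form`
  (`Iff.rfl`).
* §1 LOAD-BEARING (theorems): `TracedQuadraticParametrixWithoutRLeL` (drop `r ≤ L`) is FALSE —
  `tracedQuadraticParametrix_false_without_rLeL` (one-site torus, toron `diag(−1,−1,1)`, `m = 0`,
  `t = r² → ∞`: traced kernels `8e^{−4t}+4` vs `12`, computed exactly: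
  `wilsonDirac_toron`, `hsq_toron`, `heat_toron`, `trDiag_toron`, `trDiag_free_one`); and
  `tracedQuadraticParametrix_of_withoutRLeL` (the variant is stronger, so this does not touch the
  crux).  NOT load-bearing as far as cheap families go (analysis, §2/§4): the winding tail (flat
  torons are already inside `C(ε)(ε/L²)²` because `r ≤ L`); `1 ≤ t` (cosmetic: `corr = O(t²)` as
  `t → 0` since the column norms of `D_W` are link-independent, and the typed tail is junk-safe at
  `1 + log t = 0`); and — unlike 8871, whose bound `C/t²` decays — `t ≤ r²`: `t → ∞` limits are
  projections onto `ker D_W(U,m)`, for flat `U` absorbed by `C = 12/ε²`, for `m < 0` would-be zero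
  modes have density `≲ F² ≍ δ²` (scale covariance), so dropping `t ≤ r²` alone is not refuted by
  torons or instantons (no theorem claimed).
* §2 natural strengthenings: `TracedQuadraticParametrixEntrywise` (no trace) is false as physics
  (first order `σ₀₁F`, diagonal in the tree's chiral basis; kit j020971 exponent 1.00) — recorded
  as a `sorry`d near-miss `not_entrywise` with the formal obstruction; `…WithoutTail` is recorded
  as PROBABLY TRUE (not refutable by flat connections): information for provers, no theorem.
* §3 numerics (kit j021390 smoke, **j021409** attached to the item): `Q := corr/deficit` for
  (A) `U₀ = e^{iκσ₁/2}, U₁ = e^{iaσ₂/2} ⊂ SU(3)`, `U₂ = U₃ = 1`, exact torus momentum sums with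
  `L = N ≥ 12√t`, `a ∈ (0, π]`, `κ = 0.02` (Q is κ-independent to 3 digits for κ ≤ 0.1),
  `t ∈ [1, 4096]`, `m ∈ {−½, −¼, −0.1, 0, ½, 1}`:  `sup |Q| = 0.0165 (m=0; below the continuum
  1/(6π²) = 0.01689, approached from below at a = 0.05, t ≈ 16–32), 0.0348 (m=−½, t ≈ 1.5),
  0.0254 (−¼), 0.0202 (−0.1), 0.0035 (½), 0.0008 (1)`; crossover at `a²t ≍ 1` then decay
  `∝ 1/(a²t)` (collapse in `u = a²t`: Q(u=¼,1,4,16,64) = 0.0155, 0.0136, 0.0076, 0.0011, 0.00005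
  for a = 0.1, 0.2, 0.4 alike) — the adiabatic/geometric mass `min(κ,a)²/4` of the non-abelian
  constant potential.  (B) random almost-commuting `SU(3)` quadruples `D_μ e^{iκX_μ}` (12×12, N=24,
  t ≤ 16): generic `|Q| ≤ 0.0065 (m=0) / 0.037 (m=−½)`; degenerate strata (`all links near 1`,
  κ = 0.4; `su(2)` block on a degenerate Cartan background, κ = 0.3, deficit O(κ⁴)):
  `Q ≤ 0.060 (m=0) / 0.148 (m=−½)` at t = 1, decreasing in t.  (C/D, kit **j021487**) the
  κ → 0 limit of the worst stratum CONVERGES (`U_μ = e^{iκX_μ}`, same X, κ = 0.4, 0.2, 0.1, 0.05: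
  Q(t=1) = 0.046, 0.055, 0.058, 0.059 (m=0); 0.114, 0.129, 0.133, 0.135 (m=−½)` — `c₄(X)/d(X)`
  finite), and the nearly-commuting SMALL-potential test `A_μ = 0.3(C_μ + ηY_μ)`, `C` Cartan,
  `η = 0.5 … 0.02` (deficit `∝ η²` down to 2.4e-6) gives `Q(t=1) → 0.038–0.061 (m=0),
  0.091–0.145 (m=−½)`, FLAT in η: no term of the quartic Taylor coefficient is linear in the
  commutators (as gauge invariance + the colour trace predict: gauge the commuting part away, the
  perturbation becomes a helical `su(3)` field, its first order dies in the trace).  Every `t = 16`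
  outlier at deficit ≲ 1e-5 (Q = −0.16 …) is the N = 24 winding/toron image `≍ e^{−N²/4t} K`, an
  admissible torus effect paid by the crux's tail, absent in the bulk.  Bottom line: no growth in
  `t`, κ or η anywhere; the prover's constant must be `C ≳ 0.16` (m = −½, t ≍ 1, small constant
  non-abelian potentials: ≈ Σ over the six planes of the per-plane coefficient, vs the MAX-plaquette
  deficit).
* §4 why it resists (docstring of `whyItResists`).

Cited from the standing material: refuter-rattack CRUX-ATTACK.md (torons at r = L absorbed; kit
j020971 random rough fields `|ΔΦ|/deficit ≤ 0.003 / 0.013`); 8871's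
`SmallFieldUltracontractivity/Negative/LoadBearing.lean` (one-site torus vocabulary, imported).
-/

noncomputable section

namespace Summit.QuantumFields.QCD.Cruxes.TracedQuadraticParametrix.Disproof

open Literature.MathematicalPhysics.QuantumLattice Literature.MathematicalPhysics.QuantumFieldTheory
  Literature.Probability.LatticeModels
open Summit.QuantumFields.QCD.Theses.HeatSlicedQuarks
open scoped Matrix ComplexConjugate BigOperators

/-- `SU(3)` for short. -/
abbrev SU3 := Matrix.specialUnitaryGroup (Fin 3) ℂ

/-- The free configuration `U ≡ 1`, written exactly as in the crux. -/
abbrev freeCfg (L : ℕ) : GaugeConfig 4 L SU3 := fun _ : Edge 4 L => (1 : SU3)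

/-- The colour–spin traced on-diagonal heat kernel `Σ_{a,α} Re e^{-t D_Wᴴ D_W}((x,a,α),(x,a,α))`,
written exactly as in the crux (Wilson parameter `1`, fundamental `SU(3)`). -/
abbrev trDiag {L : ℕ} [NeZero L] (U : GaugeConfig 4 L SU3) (m t : ℝ) (x : TorusSite 4 L) : ℝ :=
  ∑ a : Fin 3, ∑ α : Fin 4, ((NormedSpace.exp (-(t : ℂ) •
    (Matrix.conjTranspose (wilsonDirac (fundamentalRep (Fin 3)) U m 1) *
      wilsonDirac (fundamentalRep (Fin 3)) U m 1))) (x, a, α) (x, a, α)).re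

/-- Global plaquette smallness `3 − Re tr U_p ≤ b` for every based plaquette, as in the crux. -/
abbrev SmallPlaq {L : ℕ} (U : GaugeConfig 4 L SU3) (b : ℝ) : Prop :=
  ∀ (y : TorusSite 4 L) (μ ν : Fin 4),
    3 - ((fundamentalRep (Fin 3)) (plaquetteHolonomy U y μ ν)).trace.re ≤ b

/-- The right-hand side `C (ε/r²)² + C e^{−cL²/(t(1+log t)²)}/t²` of the crux. -/
abbrev rhs (ε C c : ℝ) (L r : ℕ) (t : ℝ) : ℝ :=
  C * (ε / (r : ℝ) ^ 2) ^ 2 + C * Real.exp (-(c * (L : ℝ) ^ 2 / (t * (1 + Real.log t) ^ 2))) / t ^ 2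

/-- The crux, re-displayed through the abbreviations above (definitionally: `Iff.rfl`). -/
theorem crux_iff :
    TracedQuadraticParametrix ↔
      ∃ ε : ℝ, 0 < ε ∧ ∃ C c : ℝ, 0 < c ∧ ∀ (L : ℕ) [NeZero L] (U : GaugeConfig 4 L SU3) (m : ℝ),
        m ∈ Set.Icc (-(1 / 2 : ℝ)) 1 → ∀ (r : ℕ), 1 ≤ r → r ≤ L →
        SmallPlaq U ((ε / (r : ℝ) ^ 2) ^ 2) → ∀ (t : ℝ), 1 ≤ t → t ≤ (r : ℝ) ^ 2 →
        ∀ (x : TorusSite 4 L), |trDiag U m t x - trDiag (freeCfg L) m t x| ≤ rhs ε C c L r t :=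
  Iff.rfl

/-- **Variant (a1): the crux WITHOUT `r ≤ L`** (everything else verbatim).  Then `t ≤ r²` no longer
forces `t ≤ L²`, and flat connections with non-trivial holonomy (torons) break the bound at
`t = r² ≫ L²`: see `tracedQuadraticParametrix_false_without_rLeL`. -/
def TracedQuadraticParametrixWithoutRLeL : Prop :=
  ∃ ε : ℝ, 0 < ε ∧ ∃ C c : ℝ, 0 < c ∧ ∀ (L : ℕ) [NeZero L] (U : GaugeConfig 4 L SU3) (m : ℝ),
    m ∈ Set.Icc (-(1 / 2 : ℝ)) 1 → ∀ (r : ℕ), 1 ≤ r →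
    SmallPlaq U ((ε / (r : ℝ) ^ 2) ^ 2) → ∀ (t : ℝ), 1 ≤ t → t ≤ (r : ℝ) ^ 2 →
    ∀ (x : TorusSite 4 L), |trDiag U m t x - trDiag (freeCfg L) m t x| ≤ rhs ε C c L r t

/-- The variant is (trivially) STRONGER than the crux: refuting it does not refute the crux, it shows
that `r ≤ L` is load-bearing. -/
theorem tracedQuadraticParametrix_of_withoutRLeL :
    TracedQuadraticParametrixWithoutRLeL → TracedQuadraticParametrix := by
  rintro ⟨ε, hε, C, c, hc, h⟩
  exact ⟨ε, hε, C, c, hc, fun L _ U m hm r hr _ hP t ht htr x => h L U m hm r hr hP t ht htr x⟩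

/-! ### The `L = 1` toron witness -/

/-- `P = diag(−1, −1, 1) ∈ SU(3)`. -/
def Pmat : Matrix (Fin 3) (Fin 3) ℂ := Matrix.diagonal ![-1, -1, 1]

/-- `P² = 1`. -/
theorem Pmat_mul_Pmat : Pmat * Pmat = 1 := by
  ext i j
  fin_cases i <;> fin_cases j <;> simp [Pmat, Matrix.diagonal, Matrix.mul_apply]

/-- `P` is self-adjoint (real diagonal). -/
theorem star_Pmat : star Pmat = Pmat := by
  ext i j
  fin_cases i <;> fin_cases j <;> simp [Pmat, Matrix.diagonal, Matrix.star_apply]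

/-- `P` is special unitary. -/
theorem Pmat_mem : Pmat ∈ SU3 := by
  rw [Matrix.mem_specialUnitaryGroup_iff, Matrix.mem_unitaryGroup_iff, star_Pmat, Pmat_mul_Pmat]
  refine ⟨rfl, ?_⟩
  simp [Pmat, Matrix.det_diagonal, Fin.prod_univ_three]

/-- `P` as an element of `SU(3)`. -/
def Psu : SU3 := ⟨Pmat, Pmat_mem⟩

/-- The fundamental representation of `P` is the matrix `P`. -/
@[simp] theorem fundamentalRep_Psu : fundamentalRep (Fin 3) Psu = Pmat := rfl

/-- The underlying matrix of `P` is `P`. -/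
@[simp] theorem Psu_coe : (Psu : Matrix (Fin 3) (Fin 3) ℂ) = Pmat := rfl

/-- `P² = 1` in `SU(3)`. -/
theorem Psu_mul_Psu : Psu * Psu = 1 := Subtype.ext Pmat_mul_Pmat

/-- `P⁻¹ = P` in `SU(3)`. -/
theorem Psu_inv : Psu⁻¹ = Psu := by
  rw [inv_eq_iff_mul_eq_one, Psu_mul_Psu]

/-- The toron: `U(x, 0) = P`, all other links `1` (one-site torus, `L = 1`). -/
def toron : GaugeConfig 4 1 SU3 := fun e => if e.2 = 0 then Psu else 1

/-- The toron is flat: every based plaquette holonomy is `1`. -/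
theorem plaquetteHolonomy_toron (y : TorusSite 4 1) (μ ν : Fin 4) :
    plaquetteHolonomy toron y μ ν = 1 := by
  unfold plaquetteHolonomy toron
  by_cases hμ : μ = 0 <;> by_cases hν : ν = 0 <;> simp [hμ, hν, Psu_inv, Psu_mul_Psu]


/-! ### The Wilson–Dirac operator on the one-site torus
(the free one, `wilsonDirac_freeCfg_one_zero : D_W(1) = 0` at `m = 0`, and the instance
`Subsingleton (TorusSite 4 1)` are imported from the landed
`SmallFieldUltracontractivity/Negative/LoadBearing.lean`) -/

/-- Diagonal of the toron's Wilson–Dirac operator at `m = 0`: `2` on colours `0, 1`, `0` on colour `2`. -/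
def torD : TorusSite 4 1 × Fin 3 × Fin 4 → ℂ := fun i => if i.2.1 = 2 then 0 else 2

/-- The toron's Wilson–Dirac operator on the one-site torus at `m = 0`, `r = 1` is
`diag(2, 2, 0)_colour ⊗ 1_spin`. -/
theorem wilsonDirac_toron :
    wilsonDirac (fundamentalRep (Fin 3)) toron 0 1 = Matrix.diagonal torD := by
  ext ⟨x, a, α⟩ ⟨y, b, β⟩
  obtain rfl : x = y := Subsingleton.elim _ _
  fin_cases a <;> fin_cases b <;> by_cases hαβ : α = β <;>
    simp [wilsonDirac, toron, torD, Pmat, Psu_inv, hαβ, Fin.sum_univ_four, Matrix.one_apply,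
      eq_iff_true_of_subsingleton] <;> ring


/-! ### Heat kernels on the one-site torus -/

/-- `NormedSpace.exp` on `ℂ` is `Complex.exp`. -/
theorem nexp_complex (z : ℂ) : NormedSpace.exp z = Complex.exp z :=
  (congr_fun Complex.exp_eq_exp_ℂ z).symm

/-- Free traced diagonal on the one-site torus at `m = 0`: `e^{0} = 1`, twelve diagonal ones. -/
theorem trDiag_free_one (t : ℝ) (x : TorusSite 4 1) : trDiag (freeCfg 1) 0 t x = 12 := by
  simp only [trDiag,
    Summit.QuantumFields.QCD.Theorems.SmallFieldUltracontractivity.Negative.wilsonDirac_freeCfg_one_zero,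
    Matrix.conjTranspose_zero, Matrix.zero_mul, smul_zero,
    NormedSpace.exp_zero, Matrix.one_apply_eq, Complex.one_re]
  norm_num

/-- The eigenvalues of the toron's `H = Dᴴ D`: `4` on colours `0, 1`, `0` on colour `2`. -/
def torH : TorusSite 4 1 × Fin 3 × Fin 4 → ℂ := fun i => if i.2.1 = 2 then 0 else 4

/-- `D_W(toron)ᴴ D_W(toron) = diag(4,4,0)_colour ⊗ 1_spin` at `m = 0`. -/
theorem hsq_toron :
    (wilsonDirac (fundamentalRep (Fin 3)) toron 0 1)ᴴ * wilsonDirac (fundamentalRep (Fin 3)) toron 0 1 =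
      Matrix.diagonal torH := by
  rw [wilsonDirac_toron, Matrix.diagonal_conjTranspose, Matrix.diagonal_mul_diagonal]
  congr 1
  funext i
  by_cases h : i.2.1 = 2
  · norm_num [torD, torH, h]
  · norm_num [torD, torH, h]

/-- The toron heat kernel `e^{-tH}` is the diagonal matrix `diag(e^{-t·torH})`. -/
theorem heat_toron (t : ℝ) :
    NormedSpace.exp (-(t : ℂ) • ((wilsonDirac (fundamentalRep (Fin 3)) toron 0 1)ᴴ *
        wilsonDirac (fundamentalRep (Fin 3)) toron 0 1)) =
      Matrix.diagonal (fun i => Complex.exp (-(t : ℂ) * torH i)) := by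
  rw [hsq_toron, ← Matrix.diagonal_smul, Matrix.exp_diagonal]
  congr 1
  funext i
  rw [Pi.coe_exp, nexp_complex]
  rfl

/-- Toron traced diagonal on the one-site torus at `m = 0`: `8 e^{−4t} + 4`. -/
theorem trDiag_toron (t : ℝ) (x : TorusSite 4 1) : trDiag toron 0 t x = 8 * Real.exp (-(4 * t)) + 4 := by
  simp only [trDiag, heat_toron, Matrix.diagonal_apply_eq, torH]
  have h4 : (Complex.exp (-((t : ℂ) * 4))).re = Real.exp (-(4 * t)) := by
    rw [show (-((t : ℂ) * 4)) = ((-(4 * t) : ℝ) : ℂ) by push_cast; ring, Complex.exp_ofReal_re]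
  simp only [Fin.sum_univ_three, Fin.isValue, Fin.reduceEq, if_false, if_true, neg_mul, mul_zero,
    neg_zero, Complex.exp_zero, Complex.one_re, Finset.sum_const, Finset.card_univ, Fintype.card_fin,
    nsmul_eq_mul, h4]
  push_cast
  ring


/-! ### `r ≤ L` is load-bearing -/

/-- **Any proof of the crux must use `r ≤ L`.**  Without it, take the one-site torus `L = 1`, the
toron `U(·,0) = diag(−1,−1,1)` (all plaquettes trivial, so the smallness hypothesis holds for EVERY
`r`), `m = 0`, `t = r²`: the traced kernels are `8e^{−4t} + 4` (toron) and `12` (free), so the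
left side is `8 − 8e^{−4r²} ≥ 4`, while the right side `C(ε/r²)² + C e^{−c/(r²(1+log r²)²)}/r⁴ ≤
|C|(ε² + 1)/r → 0`.  (Physically: for `t ≫ L²` the free kernel is carried by its zero mode `12/L⁴`
while a flat connection with non-trivial holonomy is gapped; in the crux `t ≤ r² ≤ L²` and the
log-corrected tail `C e^{−cL²/(t(1+log t)²)}/t² → C/t²` at `t ≍ L²` absorb exactly this.) -/
theorem tracedQuadraticParametrix_false_without_rLeL : ¬ TracedQuadraticParametrixWithoutRLeL := by
  rintro ⟨ε, _hε, C, c, hc, h⟩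
  -- a large radius `n`
  have hK0 : 0 ≤ |C| * ε ^ 2 + |C| := by positivity
  obtain ⟨n, hn⟩ := exists_nat_gt (|C| * ε ^ 2 + |C|)
  have hnpos : (0 : ℝ) < n := hK0.trans_lt hn
  have hn1 : 1 ≤ n := Nat.one_le_iff_ne_zero.mpr (by rintro rfl; simp at hnpos)
  have hN : (1 : ℝ) ≤ n := by exact_mod_cast hn1
  have ht1 : (1 : ℝ) ≤ (n : ℝ) ^ 2 := by nlinarith
  have hn2 : (n : ℝ) ≤ (n : ℝ) ^ 2 := by nlinarith
  have hn4 : (n : ℝ) ≤ ((n : ℝ) ^ 2) ^ 2 := hn2.trans (by nlinarith)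
  -- the instance of the (r ≤ L)-free statement at L = 1, toron, m = 0, r = n, t = n²
  have hm : (0 : ℝ) ∈ Set.Icc (-(1 / 2 : ℝ)) 1 := by constructor <;> norm_num
  have hP : SmallPlaq toron ((ε / (n : ℝ) ^ 2) ^ 2) := by
    intro y μ ν
    simp only [plaquetteHolonomy_toron, map_one, Matrix.trace_one, Fintype.card_fin]
    norm_num
    positivity
  have key := h 1 toron 0 hm n hn1 hP ((n : ℝ) ^ 2) ht1 le_rfl (fun _ => 0)
  rw [trDiag_toron, trDiag_free_one] at key
  -- left side ≥ 4
  have hE : (2 : ℝ) ≤ Real.exp (4 * (n : ℝ) ^ 2) :=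
    le_trans (by nlinarith) (Real.add_one_le_exp _)
  have he0 : 0 < Real.exp (-(4 * (n : ℝ) ^ 2)) := Real.exp_pos _
  have he1 : Real.exp (-(4 * (n : ℝ) ^ 2)) * Real.exp (4 * (n : ℝ) ^ 2) = 1 := by
    rw [← Real.exp_add]; simp
  have he : Real.exp (-(4 * (n : ℝ) ^ 2)) ≤ 1 / 2 := by
    nlinarith [mul_le_mul_of_nonneg_left hE he0.le]
  have hX : (4 : ℝ) ≤ |8 * Real.exp (-(4 * (n : ℝ) ^ 2)) + 4 - 12| := by
    rw [abs_of_nonpos (by linarith)]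
    linarith
  -- right side ≤ (|C| ε² + |C|)/n < 1
  have hT1 : C * (ε / (n : ℝ) ^ 2) ^ 2 ≤ |C| * ε ^ 2 / n :=
    calc C * (ε / (n : ℝ) ^ 2) ^ 2 ≤ |C| * (ε / (n : ℝ) ^ 2) ^ 2 :=
          mul_le_mul_of_nonneg_right (le_abs_self C) (sq_nonneg _)
      _ = |C| * ε ^ 2 / ((n : ℝ) ^ 2) ^ 2 := by rw [div_pow]; ring
      _ ≤ |C| * ε ^ 2 / n := div_le_div_of_nonneg_left (by positivity) hnpos hn4
  have hA : Real.exp (-(c * ((1 : ℕ) : ℝ) ^ 2 / ((n : ℝ) ^ 2 * (1 + Real.log ((n : ℝ) ^ 2)) ^ 2))) ≤ 1 :=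
    Real.exp_le_one_iff.mpr (neg_nonpos.mpr (by positivity))
  have hT2 : C * Real.exp (-(c * ((1 : ℕ) : ℝ) ^ 2 / ((n : ℝ) ^ 2 * (1 + Real.log ((n : ℝ) ^ 2)) ^ 2))) /
      ((n : ℝ) ^ 2) ^ 2 ≤ |C| / n := by
    set e := Real.exp (-(c * ((1 : ℕ) : ℝ) ^ 2 / ((n : ℝ) ^ 2 * (1 + Real.log ((n : ℝ) ^ 2)) ^ 2)))
    have hepos : 0 ≤ e := Real.exp_nonneg _
    calc C * e / ((n : ℝ) ^ 2) ^ 2 ≤ |C| * e / ((n : ℝ) ^ 2) ^ 2 := by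
          gcongr; exact le_abs_self C
      _ ≤ |C| * 1 / ((n : ℝ) ^ 2) ^ 2 := by gcongr
      _ = |C| / ((n : ℝ) ^ 2) ^ 2 := by ring
      _ ≤ |C| / n := div_le_div_of_nonneg_left (abs_nonneg C) hnpos hn4
  have hsum : |C| * ε ^ 2 / n + |C| / n = (|C| * ε ^ 2 + |C|) / n := by ring
  have hlt : (|C| * ε ^ 2 + |C|) / (n : ℝ) < 1 := (div_lt_one hnpos).mpr hn
  have hrhs : rhs ε C c 1 n ((n : ℝ) ^ 2) ≤ |C| * ε ^ 2 / n + |C| / n := add_le_add hT1 hT2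
  linarith


/-! ### §2 Natural strengthenings -/

/-- **Strengthening E (no trace): entrywise second order.**  The crux with the colour–spin trace
removed: every diagonal ENTRY of the correction would be `O((ε/r²)²)`.  False as physics: at first
order the Pauli term `σ₀₁F₀₁ = i γ₀γ₁ F` is DIAGONAL in the tree's chiral basis
(`γ₀γ₁ = i·1 ⊗ σ_z`), so in constant Cartan flux `θ = ε/r²` (admissible on tori with
`θL² ∈ 2πℤ`) the entry `((x,a,α),(x,a,α))` moves by `± c θ t · K_1(t)(x,x) ≍ ±θ/t` at `t ≍ 1`,
i.e. by `ε/r² ≫ (ε/r²)²` as `r → ∞` (kit j020971 of refuter-rattack: entry exponent 1.00 vs traced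
2.00 on random fields; the landed entrywise bound `parametrixDiagonalLog_holds` is `C(εt/r²)/t²`,
sharp in this sense). -/
def TracedQuadraticParametrixEntrywise : Prop :=
  ∃ ε : ℝ, 0 < ε ∧ ∃ C c : ℝ, 0 < c ∧ ∀ (L : ℕ) [NeZero L] (U : GaugeConfig 4 L SU3) (m : ℝ),
    m ∈ Set.Icc (-(1 / 2 : ℝ)) 1 → ∀ (r : ℕ), 1 ≤ r → r ≤ L →
    SmallPlaq U ((ε / (r : ℝ) ^ 2) ^ 2) → ∀ (t : ℝ), 1 ≤ t → t ≤ (r : ℝ) ^ 2 →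
    ∀ (x : TorusSite 4 L) (a : Fin 3) (α : Fin 4),
      |((NormedSpace.exp (-(t : ℂ) • (Matrix.conjTranspose (wilsonDirac (fundamentalRep (Fin 3)) U m 1) *
          wilsonDirac (fundamentalRep (Fin 3)) U m 1))) (x, a, α) (x, a, α)).re -
        ((NormedSpace.exp (-(t : ℂ) • (Matrix.conjTranspose
          (wilsonDirac (fundamentalRep (Fin 3)) (freeCfg L) m 1) *
          wilsonDirac (fundamentalRep (Fin 3)) (freeCfg L) m 1))) (x, a, α) (x, a, α)).re| ≤
        rhs ε C c L r t

/-- NEAR-MISS (cannot close formally this cycle): `¬ TracedQuadraticParametrixEntrywise`.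
Witness family (paper): constant Cartan flux `diag(e^{iθ},e^{−iθ},1)` in the (0,1) plane with
`θ = 2π/L₀²`, `r² = εL₀²/(2π)`, `L = L₀ → ∞`, `m = 0`, `t = 1`, entry `(a,α) = (0,0)`: first-order
Landau/Pauli shift `≍ θ`, bound `≍ θ²`.  OBSTRUCTION: the statement is `∃ε ∃C`, so only an `L → ∞`
family refutes it, and the formal lower bound needs first-order perturbation theory of
`exp(−t DᴴD)` on growing tori with a remainder estimate (Duhamel + the landed Davies–Gaffney bound
would do it; ≈ 400 lines, not attempted in cycle 1).  Tried: nothing finite works (`L ≤ L₀` is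
absorbed by `C e^{−cL₀²}`). -/
theorem not_entrywise : ¬ TracedQuadraticParametrixEntrywise := by
  sorry

/-- **Weakening-candidate T (no tail): PROBABLY STILL TRUE — information for provers.**  The crux
with the winding tail `C e^{−cL²/(t(1+log t)²)}/t²` deleted.  Flat connections do NOT refute it:
with all plaquettes trivial the hypothesis holds at `r = L`, and the image/winding contribution of a
flat connection obeys `|corr| ≤ c₀ sup_{s≤1} s⁻²e^{−1/(4Ds)}/L⁴ ≤ 35/L⁴ = (35/ε²)·(ε/L²)²`
(`D = 1+m ≤ 2`), i.e. it is ALREADY inside the first term with an `ε`-dependent constant, because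
`r ≤ L` forces `(ε/r²)² ≥ ε²/L⁴ ≍ ε²/t²` at `t ≍ L²`, while for `t ≲ L` the Poissonian images
`~ t^L e^{−2t}/L!` are far below `ε²/L⁴`.  So the tail is not load-bearing against torons; whether a
proof can avoid it is a different matter (the comb-gauge seam).  No theorem is claimed. -/
def TracedQuadraticParametrixWithoutTail : Prop :=
  ∃ ε : ℝ, 0 < ε ∧ ∃ C : ℝ, ∀ (L : ℕ) [NeZero L] (U : GaugeConfig 4 L SU3) (m : ℝ),
    m ∈ Set.Icc (-(1 / 2 : ℝ)) 1 → ∀ (r : ℕ), 1 ≤ r → r ≤ L →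
    SmallPlaq U ((ε / (r : ℝ) ^ 2) ^ 2) → ∀ (t : ℝ), 1 ≤ t → t ≤ (r : ℝ) ^ 2 →
    ∀ (x : TorusSite 4 L), |trDiag U m t x - trDiag (freeCfg L) m t x| ≤ C * (ε / (r : ℝ) ^ 2) ^ 2

/-- The tail-free form trivially implies the crux (take `c = 1`; the tail is nonnegative once
`0 ≤ C`, which the instance `U ≡ 1` forces). -/
theorem tracedQuadraticParametrix_of_withoutTail :
    TracedQuadraticParametrixWithoutTail → TracedQuadraticParametrix := by
  rintro ⟨ε, hε, C, h⟩
  refine ⟨ε, hε, C, 1, one_pos, fun L _ U m hm r hr hrL hP t ht htr x => ?_⟩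
  have hC : 0 ≤ C := by
    have h0 := h L (freeCfg L) m hm r hr hrL ?_ t ht htr x
    · rw [sub_self, abs_zero] at h0
      have hsq : 0 < (ε / (r : ℝ) ^ 2) ^ 2 := by positivity
      nlinarith
    · intro y μ ν
      rw [Summit.QuantumFields.QCD.Theorems.SmallFieldUltracontractivity.Negative.deficit_freeCfg]
      positivity
  have htail : 0 ≤ C * Real.exp (-(1 * (L : ℝ) ^ 2 / (t * (1 + Real.log t) ^ 2))) / t ^ 2 := by
    positivity
  exact (h L U m hm r hr hrL hP t ht htr x).trans (le_add_of_nonneg_right htail)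

/-! ### §4 Why the crux resists (analysis record) -/

/-- **Why `TracedQuadraticParametrix` resists (cycle 1).**  `True`, carrying the analysis:

1. SHAPE.  `∃ε ∃C`: a refutation needs `sup |corr| / ((ε/r²)² + tail) = ∞` over admissible
   `(L,U,m,r,t,x)` for EVERY `ε`; any bounded-`L` family is absorbed (`tail ≥ Ce^{−cL₀²}/L₀⁴`), so
   only `L → ∞`, `r → ∞` families count, and there `tδ ≤ ε` (`δ := ε/r²`): the deep perturbative
   regime.  The content is `|corr| ≤ C·δ²` uniformly in `1 ≤ t ≤ ε/δ`, including `t ≍ 1`.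
2. FLAT TORONS (r = L): absorbed (§2 `…WithoutTail` docstring); at `t ≍ L²` additionally the log in
   the tail makes it `→ C/t²`.  `r ≤ L` is exactly what keeps `t ≤ L²`: §1.
3. GAUGE INVARIANCE + PARITY ⇒ δ².  For the two-direction constant family `E(κ,a)`:
   `E − free` vanishes on both axes (pure gauges) and is even in each variable (site reflections
   `x_μ ↦ −x_μ` send `U_μ ↦ U_μ†` and conjugate the diagonal block by a spin unitary), hence
   `= κ²a²·g(κ,a;t)` with deficit `= 2sin²(a/2)(1−cos κ) ≍ κ²a²/4`; boundedness of `g` uniformly in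
   `t` is the only question, and for `a²t ≫ 1` adiabatic decoupling of the two colour sectors
   (momentum shifts `±a/2`) leaves a geometric mass `min(κ,a)²/4` (continuum: the spectrum of
   `(p+A)²` for constant non-commuting `su(2)` potentials is `(|p₁|∓a/2)² + κ²/4 + …`), so
   `corr ≍ −κ²/t`, DEcaying: §3 numerics confirm the crossover and `sup Q ≈ 1/(6π²)` at `m = 0`.
   In the continuum scalar model the whole two-parameter function is explicit:
   `corr = z(tκ², ta²)/(4πt²)`, `z(α,β) = ∫d²u e^{−u²}[2e^{−(α+β)/4}cosh√(αu₀²+βu₁²) − 2]/(2π)²`,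
   `z ≈ −αβ/(48π)` near 0 and `≈ −β/(8π)` for `α → ∞`: `z/(αβ)` is bounded on `αβ ≤ 4ε²`.
4. ROUGH FIELDS, SECOND ORDER.  With the colour trace the `su(3)`-linear term is identically zero;
   the quadratic term is `Σ_k |F̂(k)|² g(t,k)` with a bounded multiplier (`g → a₂`-value as
   `tk² → 0`, `g ≍ 1/(tk²)` as `tk² → ∞`, the Barvinsky–Vilkovisky form factor), so no `log t`:
   the marginal log of `d = 4` appears only after `∫dt/t`.  Pointwise in `x` the kernel is
   `t⁻¹|y−z|⁻² e^{−|y−z|/√t}`-like, `L¹`-bounded uniformly in `t` ⇒ `|corr(x)| ≤ C sup F²`.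
   Large rough `A` is gauge (axial gauge: `|A| ≲ δ·d` up to `d ≍ 1/δ ≫ √t`), and the trace is gauge
   invariant, so "large `A`, small `F`" exists only through flat backgrounds (item 3 / torons).
5. MASS.  For `m ∈ [−½,0)` the gap `m²` of `H_1` persists for `H_U` up to `O(δ)` (Lichnerowicz:
   `H ≈ m² + 2(1+m)W − σF`), and the traced first-order shifts come in `±` pairs:
   `cosh(cδt) − 1 = O(δ²t²)·e^{−m²t}/t² = O(δ²)`.  Numerically `m = −½` is the worst mass
   (Q up to 0.035–0.06 at `t ≍ 1`), still bounded.
6. WHAT WOULD KILL IT.  A family with `|corr|/δ² → ∞` needs a genuinely new mechanism: e.g. a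
   lattice-artefact first-order term surviving the FULL trace (impossible: `tr A = 0` exactly), or a
   second-order kernel with unbounded `ℓ¹` norm (a `log t` from an `|y−z|⁻⁴` singularity — excluded
   by the form-factor decay).  The planner's feared `(d+1)²δ²` comb-gauge growth is a gauge artefact
   of the proof technique, not of the quantity. -/
theorem whyItResists : True := trivial

end Summit.QuantumFields.QCD.Cruxes.TracedQuadraticParametrix.Disproof
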